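import Literature.MathematicalPhysics.QuantumFieldTheory.Balaban1983to89.T4LoopHolonomyHaarLaw

/-!
# NE7ApexHotHaarLaw — row NE7 (node U5), the OWNER's calibration duty, family 2 («hot», β = 0): under the product Haar measure the
# JOINT LAW of the holonomies of finitely many closed loops with PRIVATE HEAD BONDS is the product Haar measure `Haar^ι`

Lineage `b2b-balaban-t4-ne7-p1` (CRUX PROVER NE7 #1 = OWNER of BINDER row NE7), generation 37.  Tags **[folklore]** throughout
(0 `cite`): every statement below is PROVED here from Mathlib and from already-landed leaves used BY NAME — `Setup` (`GaugeField`,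
`fieldMeasure P j G = Π_b dHaar`, the `HaarData` field `map_mul_right`), `AveragingRT` (probability instances), `T4TreeGaugeFixing`
(`ClosedLoopIn`), `T4TreeGaugeTransform` (`loopHol`, `measurable_loopHol`, `chainHol_congr`, `lidx`, `bond_lidx_ne`),
`T4TreeGaugeHolonomyLaw` (`loopTail`, `loopHol_eq_head_mul_tail'`) and `T4LoopHolonomyHaarLaw` (`map_haar_inv_mul_right`; its §2 is the
ONE-loop case `map_loopHol` of the theorem below).  Nothing printed is asserted and nothing internally minted is cited (ABSOLUTE RULE).

## What is proved (`[GaugeGroup G] [MeasurableSpace G] [HaarData G] [MeasurableMul₂ G] [MeasurableInv G]`, `dU = fieldMeasure P j G`)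

A finite family of closed loops `(σ i, β i)_{i : ι}` of the `j`-th lattice (`ClosedLoopIn univ (k i) (σ i) (β i)`) has PRIVATE HEADS when
the head bond `β i 0` of loop `i` is not a bond of any other loop of the family (`hP : ∀ i i', i ≠ i' → ∀ m, β i' m ≠ β i 0`; inside
its own loop it does not recur by `bond_inj`).  Example: loops that are pairwise bond-disjoint; lattice lines in distinct directions.
* §1 `loopTail_updateFinset_heads` — the tails do not see the head variables; `loopHol_updateFinset_heads` — after updating ALL head
  variables at once, `hol_i = y(β i 0)^{±1} · tail_i` (simultaneous form of `loopHol_update`).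
* §2 **`lintegral_comp_loopHols`**: `∫ f(hol₁ U, …, hol_n U) dU = ∫ f dHaar^ι` for measurable `f : (ι → G) → ℝ≥0∞` — ONE simultaneous
  peel of the head variables (Mathlib `lintegral_eq_of_lmarginal_eq` on the finset of head bonds): the inner integral over the heads is
  the Haar^ι-integral of `f` transported along `y ↦ (y(β i 0)^{±1} · tail_i)_i` = (reindexing `measurePreserving_piCongrLeft`) then
  (coordinatewise Haar-preserving maps, `measurePreserving_pi`), hence the constant `∫ f dHaar^ι`; the outer marginal of a constant
  is the constant.  **`map_loopHols`**: `dU.map (U ↦ (hol_i U)_i) = Measure.pi (fun _ => Haar)` — THE HOLONOMIES OF PRIVATE-HEADED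
  LOOPS ARE INDEPENDENT AND EACH HAAR-DISTRIBUTED; `measurePreserving_loopHols`; Bochner form `integral_comp_loopHols`.

HONEST FRAMING: [folklore] (single-link integration / independence of link variables off a maximal tree — the first identity of every
strong-coupling expansion); a LEMMA for the owner's hot calibration family of node U5∕U0's apex PREDICATES (`NE7ApexHotScheme`,
`NE7ApexHotWitness`); NOT an estimate of Bałaban's, NOT NE7, NOT summit progress.  FIXED FINITE T⁴, rung (B)+1; spine 0∕9; NOT infinite
volume, NOT mass gap, NOT BetaPertH, NOT Clay.  HONEST DEPENDENCY: continuum YM on T⁴ ⇐ BetaPertH ∧ nine spine estimates (0/9 proved);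
BetaPertH ⇐ (D1) ∧ (D4) ∧ CAP+tail; G-an2-4 gates asym, D1 and NE2/3/4.
-/

set_option autoImplicit false

noncomputable section

open MeasureTheory Function Finset
open scoped ENNReal

namespace Summit.QuantumFields.BalabanUV.T4Continuum.NE7ApexHotHaarLaw

open Literature.MathematicalPhysics.QuantumFieldTheory.Balaban1983to89
open T4TreeGaugeFixing (ClosedLoopIn)
open T4TreeGaugeTransform (loopHol measurable_loopHol chainHol_congr lidx lidx_zero bond_lidx_ne)
open T4TreeGaugeHolonomyLaw (loopTail loopHol_eq_head_mul_tail')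
open T4LoopHolonomyHaarLaw (map_haar_inv_mul_right)

/-! ## §1 Updating all head variables at once -/

section Heads

variable {P : Params} {j : ℕ} {G : Type*} [GaugeGroup G] [DecidableEq (PBond P j)]
variable {ι : Type*} [Fintype ι] {k : ι → ℕ} {σ : (i : ι) → Fin (k i + 1) → Site P j}
  {β : (i : ι) → Fin (k i + 1) → PBond P j}

omit [DecidableEq (PBond P j)] [Fintype ι] in
/-- A non-head bond `β i (m+1)` (`m < k i`) of a private-headed family of closed loops is not a head bond `β i' 0`. [folklore] -/
theorem bond_succ_ne_head (hL : ∀ i, ClosedLoopIn univ (k i) (σ i) (β i)) (hP : ∀ i i', i ≠ i' → ∀ m, β i' m ≠ β i 0)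
    (i i' : ι) {m : ℕ} (hm : m < k i) : β i (lidx (k i) (m + 1)) ≠ β i' 0 := by
  by_cases h : i = i'
  · cases h
    have := bond_lidx_ne (hL i) m.succ_pos (Nat.succ_lt_succ hm)
    rwa [lidx_zero] at this
  · exact hP i' i (Ne.symm h) _

/-- The head bonds of the family, as a finset. [folklore] -/
theorem mem_image_heads (i : ι) : β i 0 ∈ univ.image (fun i' => β i' 0) :=
  mem_image_of_mem _ (mem_univ i)

/-- THE TAILS DO NOT SEE THE HEAD VARIABLES: updating every head bond leaves every tail unchanged. [folklore] -/
theorem loopTail_updateFinset_heads (hL : ∀ i, ClosedLoopIn univ (k i) (σ i) (β i))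
    (hP : ∀ i i', i ≠ i' → ∀ m, β i' m ≠ β i 0) (x : GaugeField P j G)
    (y : ↥(univ.image (fun i' => β i' 0)) → G) (i : ι) :
    loopTail (σ i) (β i) (updateFinset x (univ.image (fun i' => β i' 0)) y) = loopTail (σ i) (β i) x :=
  chainHol_congr _ _ fun m hm => by
    have hnot : β i (lidx (k i) (m + 1)) ∉ univ.image (fun i' => β i' 0) := by
      intro hmem
      obtain ⟨i', -, hi'⟩ := mem_image.mp hmem
      exact bond_succ_ne_head hL hP i i' hm hi'.symm
    simp only [updateFinset, dif_neg hnot]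

/-- AFTER UPDATING ALL HEADS: `hol_i(x[heads ↦ y]) = y(β i 0)^{±1} · tail_i(x)` (sign = orientation of `β i 0`). [folklore] -/
theorem loopHol_updateFinset_heads (hL : ∀ i, ClosedLoopIn univ (k i) (σ i) (β i))
    (hP : ∀ i i', i ≠ i' → ∀ m, β i' m ≠ β i 0) (x : GaugeField P j G)
    (y : ↥(univ.image (fun i' => β i' 0)) → G) (i : ι) :
    loopHol (σ i) (β i) (updateFinset x (univ.image (fun i' => β i' 0)) y) =
      (if (β i 0).src = σ i 0 then y ⟨β i 0, mem_image_heads i⟩ else (y ⟨β i 0, mem_image_heads i⟩)⁻¹) *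
        loopTail (σ i) (β i) x := by
  rw [loopHol_eq_head_mul_tail', loopTail_updateFinset_heads hL hP]
  have hval : updateFinset x (univ.image (fun i' => β i' 0)) y (β i 0) = y ⟨β i 0, mem_image_heads i⟩ := by
    simp only [updateFinset, dif_pos (mem_image_heads i)]
  rw [hval]

end Heads

/-! ## §2 The joint law of private-headed loops is `Haar^ι` -/

section Law

variable {P : Params} {j : ℕ} {G : Type*} [GaugeGroup G] [MeasurableSpace G] [HaarData G] [MeasurableMul₂ G]
  [MeasurableInv G] [DecidableEq (PBond P j)]
variable {ι : Type*} [Fintype ι] {k : ι → ℕ} {σ : (i : ι) → Fin (k i + 1) → Site P j}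
  {β : (i : ι) → Fin (k i + 1) → PBond P j}

/-- One coordinate of the transport: `g ↦ g^{±1} · t` preserves Haar measure. [folklore] -/
theorem measurePreserving_ite_mul (p : Prop) [Decidable p] (t : G) :
    MeasurePreserving (fun g : G => (if p then g else g⁻¹) * t) (HaarData.haar : Measure G) (HaarData.haar : Measure G) := by
  by_cases hp : p
  · simp only [if_pos hp]
    exact ⟨measurable_id.mul_const t, HaarData.map_mul_right t⟩
  · simp only [if_neg hp]
    exact ⟨measurable_inv.mul_const t, map_haar_inv_mul_right t⟩

omit [HaarData G] [DecidableEq (PBond P j)] [Fintype ι] in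
/-- The vector of loop holonomies is measurable. [folklore] -/
theorem measurable_loopHols :
    Measurable fun (U : GaugeField P j G) (i : ι) => loopHol (σ i) (β i) U :=
  measurable_pi_lambda _ fun i => measurable_loopHol (σ i) (β i)

/-- **`∫ f(hol₁ U, …, hol_n U) dU = ∫ f dHaar^ι`** for a private-headed family of closed loops and measurable `f : (ι → G) → ℝ≥0∞`.
[folklore] -/
theorem lintegral_comp_loopHols (hL : ∀ i, ClosedLoopIn univ (k i) (σ i) (β i))
    (hP : ∀ i i', i ≠ i' → ∀ m, β i' m ≠ β i 0) {f : (ι → G) → ℝ≥0∞} (hf : Measurable f) :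
    ∫⁻ U, f (fun i => loopHol (σ i) (β i) U) ∂fieldMeasure P j G =
      ∫⁻ g, f g ∂Measure.pi (fun _ : ι => (HaarData.haar : Measure G)) := by
  set C : ℝ≥0∞ := ∫⁻ g, f g ∂Measure.pi (fun _ : ι => (HaarData.haar : Measure G)) with hC
  -- the bijection `ι ≃ heads` (heads = `univ.image (fun i' => β i' 0)`)
  have hinj : Function.Injective
      (fun i : ι => (⟨β i 0, mem_image_heads i⟩ : ↥(univ.image (fun i' => β i' 0)))) := by
    intro i i' h
    by_contra hne
    have h' : β i 0 = β i' 0 := congrArg Subtype.val h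
    exact hP i i' hne 0 h'.symm
  have hsurj : Function.Surjective
      (fun i : ι => (⟨β i 0, mem_image_heads i⟩ : ↥(univ.image (fun i' => β i' 0)))) := by
    rintro ⟨b, hb⟩
    obtain ⟨i, -, hi⟩ := mem_image.mp hb
    exact ⟨i, Subtype.ext hi⟩
  let e : ι ≃ ↥(univ.image (fun i' => β i' 0)) := Equiv.ofBijective _ ⟨hinj, hsurj⟩
  have hF : Measurable fun U : GaugeField P j G => f (fun i => loopHol (σ i) (β i) U) := hf.comp measurable_loopHols
  -- reindexing `(heads → G) → (ι → G)` along `e` preserves the product Haar measure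
  let R : (↥(univ.image (fun i' => β i' 0)) → G) → (ι → G) := fun y i => y (e i)
  have hR : MeasurePreserving R (Measure.pi fun _ : ↥(univ.image (fun i' => β i' 0)) => (HaarData.haar : Measure G))
      (Measure.pi fun _ : ι => (HaarData.haar : Measure G)) := by
    have h := measurePreserving_piCongrLeft (fun _ : ι => (HaarData.haar : Measure G)) e.symm
    have hRe : R = ⇑(MeasurableEquiv.piCongrLeft (fun _ : ι => G) e.symm) := by
      funext y i
      have happ := MeasurableEquiv.piCongrLeft_apply_apply (β := fun _ => G) e.symm y (e i)
      rw [Equiv.symm_apply_apply] at happ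
      exact happ.symm
    rw [hRe]
    exact h
  -- the marginal over the heads is the constant `C`
  have key : (∫⋯∫⁻_(univ.image (fun i' => β i' 0)), (fun U : GaugeField P j G => f (fun i => loopHol (σ i) (β i) U))
        ∂(fun _ : PBond P j => (HaarData.haar : Measure G))) =
      (∫⋯∫⁻_(univ.image (fun i' => β i' 0)), (fun _ => C) ∂(fun _ : PBond P j => (HaarData.haar : Measure G))) := by
    funext x
    -- the tails at `x`, and the coordinatewise transport
    let t : ι → G := fun i => loopTail (σ i) (β i) x
    let step : ι → G → G := fun i g => (if (β i 0).src = σ i 0 then g else g⁻¹) * t i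
    have hΘ : MeasurePreserving (fun (z : ι → G) (i : ι) => step i (z i))
        (Measure.pi fun _ : ι => (HaarData.haar : Measure G)) (Measure.pi fun _ : ι => (HaarData.haar : Measure G)) :=
      measurePreserving_pi (fun _ : ι => (HaarData.haar : Measure G)) (fun _ : ι => (HaarData.haar : Measure G))
        fun i => measurePreserving_ite_mul ((β i 0).src = σ i 0) (t i)
    have hpt : ∀ y : ↥(univ.image (fun i' => β i' 0)) → G,
        (fun i => loopHol (σ i) (β i) (updateFinset x (univ.image (fun i' => β i' 0)) y)) = fun i => step i (R y i) :=
      fun y => funext fun i => (loopHol_updateFinset_heads hL hP x y i).trans rfl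
    simp only [lmarginal]
    calc ∫⁻ y, f (fun i => loopHol (σ i) (β i) (updateFinset x (univ.image (fun i' => β i' 0)) y))
          ∂(Measure.pi fun _ : ↥(univ.image (fun i' => β i' 0)) => (HaarData.haar : Measure G))
        = ∫⁻ y, (fun z : ι → G => f (fun i => step i (z i))) (R y)
            ∂(Measure.pi fun _ : ↥(univ.image (fun i' => β i' 0)) => (HaarData.haar : Measure G)) := by
          refine lintegral_congr fun y => ?_
          rw [hpt y]
      _ = ∫⁻ z, f (fun i => step i (z i)) ∂(Measure.pi fun _ : ι => (HaarData.haar : Measure G)) :=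
          hR.lintegral_comp (hf.comp hΘ.measurable)
      _ = C := hΘ.lintegral_comp hf
      _ = ∫⁻ _, C ∂(Measure.pi fun _ : ↥(univ.image (fun i' => β i' 0)) => (HaarData.haar : Measure G)) := by
          rw [lintegral_const, measure_univ, mul_one]
  have h := lintegral_eq_of_lmarginal_eq (μ := fun _ : PBond P j => (HaarData.haar : Measure G))
    (univ.image (fun i' => β i' 0)) hF measurable_const key
  calc ∫⁻ U, f (fun i => loopHol (σ i) (β i) U) ∂fieldMeasure P j G
      = ∫⁻ U, f (fun i => loopHol (σ i) (β i) U) ∂(Measure.pi fun _ : PBond P j => (HaarData.haar : Measure G)) := rfl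
    _ = ∫⁻ _, C ∂(Measure.pi fun _ : PBond P j => (HaarData.haar : Measure G)) := h
    _ = C := by rw [lintegral_const, measure_univ, mul_one]

/-- **THE JOINT LAW OF PRIVATE-HEADED LOOPS IS `Haar^ι`**: the holonomies are independent and each Haar-distributed. [folklore] -/
theorem map_loopHols (hL : ∀ i, ClosedLoopIn univ (k i) (σ i) (β i)) (hP : ∀ i i', i ≠ i' → ∀ m, β i' m ≠ β i 0) :
    (fieldMeasure P j G).map (fun U i => loopHol (σ i) (β i) U) = Measure.pi (fun _ : ι => (HaarData.haar : Measure G)) :=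
  Measure.ext_of_lintegral _ fun f hf => by
    rw [lintegral_map hf measurable_loopHols]
    exact lintegral_comp_loopHols hL hP hf

/-- `U ↦ (hol_i U)_i` is measure preserving `(GaugeField, dU) → (ι → G, Haar^ι)`. [folklore] -/
theorem measurePreserving_loopHols (hL : ∀ i, ClosedLoopIn univ (k i) (σ i) (β i))
    (hP : ∀ i i', i ≠ i' → ∀ m, β i' m ≠ β i 0) :
    MeasurePreserving (fun (U : GaugeField P j G) (i : ι) => loopHol (σ i) (β i) U) (fieldMeasure P j G)
      (Measure.pi fun _ : ι => (HaarData.haar : Measure G)) :=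
  ⟨measurable_loopHols, map_loopHols hL hP⟩

/-- Bochner form: `∫ f(hol₁ U, …, hol_n U) dU = ∫ f dHaar^ι` for measurable real `f`. [folklore] -/
theorem integral_comp_loopHols (hL : ∀ i, ClosedLoopIn univ (k i) (σ i) (β i))
    (hP : ∀ i i', i ≠ i' → ∀ m, β i' m ≠ β i 0) {f : (ι → G) → ℝ} (hf : Measurable f) :
    ∫ U, f (fun i => loopHol (σ i) (β i) U) ∂fieldMeasure P j G =
      ∫ g, f g ∂Measure.pi (fun _ : ι => (HaarData.haar : Measure G)) := by
  rw [← map_loopHols (G := G) hL hP, integral_map measurable_loopHols.aemeasurable hf.aestronglyMeasurable]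

end Law

end Summit.QuantumFields.BalabanUV.T4Continuum.NE7ApexHotHaarLaw

end
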